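import Literature.ModelTheory.ExponentialFields.KhovanskiiLocalMin
import Literature.ModelTheory.ExponentialFields.LagrangeSystem
import Literature.ModelTheory.ExponentialFields.KhovanskiiZeroBound
import Mathlib.MeasureTheory.Function.Jacobian
import HarnessLib

/-!
# Khovanskii's component count II: uniformly many connected components of regular zero sets

Topic `Literature/ModelTheory/ExponentialFields`. From the uniform bound on non-degenerate zeros of
square systems of `L_exp`-terms (`KhovanskiiZeroBound.lean`) to a uniform bound on the **number of
connected components** of the real zero set of an arbitrary system `g₁(ȳ, z̄), …, g_q(ȳ, z̄)` at
parameters `β` at which every zero is regular (`Khovanskii.exists_forall_encard_components_le`).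
This is the Morse-theoretic step of Khovanskii's theory (A. G. Khovanskii, *Fewnomials* (1991),
Ch. III §§3.8–3.14: the number of components of a regular level set is bounded through numbers of
non-degenerate zeros of auxiliary square systems), in the form needed for A. J. Wilkie,
Illinois J. Math. 33 (1989), §5, Proposition. Everything is **proved**:

given more than `C` components (`C` the zero bound of the Lagrange system `LagrangeSystem.lean`),
choose a compact piece `K ∩ {Σ zⱼ² ≤ R}` of each and pairwise disjoint compact collars `U_K` around
them (`Disjoint.exists_cthickenings`; the complement of a component is closed because regular
zero sets are locally connected, `RegularZeroSet.lean`); for `θ = (c, e)` close to `0` the squared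
distance has a regular local minimum on `{g(β, ·) = e}` inside every collar
(`KhovanskiiLocalMin.lean`), hence, by Lagrange multipliers, the map `Ψ_β` of the Lagrange system
takes the value `θ` at more than `C` points; choosing `θ` outside the Lebesgue-null set of critical
values of `Ψ_β` (Sard's theorem in equal dimensions, Mathlib
`MeasureTheory.addHaar_image_eq_zero_of_det_fderivWithin_eq_zero`) makes all these points
non-degenerate zeros of the Lagrange system — more than `C` of them, a contradiction.

## References

* A. G. Khovanskii, *Fewnomials*, Transl. Math. Monogr. 88, AMS (1991), Ch. III. [Khovanskii1991]
* A. J. Wilkie, *On the theory of the real exponential field*, Illinois J. Math. 33 (1989), §5,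
  Proposition (p. 402). [Wilkie1989]
* J. Milnor, *Topology from the Differentiable Viewpoint* (1965), §1–§2. [MilnorTDV1965]
-/

noncomputable section

open FirstOrder FirstOrder.Language FirstOrder.Language.Structure
open Set Filter Metric MeasureTheory
open scoped Topology

namespace Literature.ModelTheory.ExponentialFields

namespace Khovanskii

open ExpTerm RealExpModel

variable {m k q : ℕ} (g : Fin q → Language.orderedExpRing.Term (Fin m ⊕ Fin k)) (β : Fin m → ℝ)

/-! ### The component bound -/

/-- Distinct connected components are disjoint. [folklore] -/
theorem disjoint_of_ne_connectedComponentIn {X : Type*} [TopologicalSpace X] {W : Set X} {a a' : X}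
    (h : connectedComponentIn W a ≠ connectedComponentIn W a') :
    Disjoint (connectedComponentIn W a) (connectedComponentIn W a') := by
  rw [Set.disjoint_iff]
  rintro x ⟨hx, hx'⟩
  exact h ((connectedComponentIn_eq hx).trans (connectedComponentIn_eq hx').symm)

/-- A Lebesgue-null set does not contain a ball. [folklore] -/
theorem exists_mem_ball_notMem {n : ℕ} {Bad : Set (Fin n → ℝ)} (hBad : volume Bad = 0) {ε : ℝ}
    (hε : 0 < ε) : ∃ θ ∈ ball (0 : Fin n → ℝ) ε, θ ∉ Bad := by
  by_contra hcon
  push Not at hcon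
  have h1 : volume (ball (0 : Fin n → ℝ) ε) ≤ volume Bad := measure_mono fun θ hθ => hcon θ hθ
  rw [hBad, nonpos_iff_eq_zero] at h1
  exact (isOpen_ball.measure_pos volume ⟨0, mem_ball_self hε⟩).ne' h1

/-- **Khovanskii's theorem, component form, for regular zero sets of `L_exp`-terms.** For every
system `g₁(ȳ, z̄), …, g_q(ȳ, z̄)` of terms there is `N ∈ ℕ` such that for every `β ∈ ℝᵐ` at
which all real zeros of `g(β, ·)` are regular (gradient rows independent), the zero set
`{z ∈ ℝᵏ : g(β, z) = 0}` has at most `N` connected components. [cite: Khovanskii1991, Ch. III] [cite: Wilkie1989, §5, Proposition, p. 402] -/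
theorem exists_forall_encard_components_le :
    ∃ N : ℕ, ∀ β : Fin m → ℝ, (∀ z ∈ zeroSetR g β, LinearIndependent ℝ (fun i => grad (g i) β z)) →
      (Set.range fun z : zeroSetR g β => connectedComponentIn (zeroSetR g β) (z : Fin k → ℝ)).encard ≤ N := by
  classical
  obtain ⟨C, hC⟩ := exists_forall_encard_ndZeros_le (lagSys g)
  refine ⟨C, fun β hreg => ?_⟩
  set W := zeroSetR g β with hW
  set Comps := Set.range fun z : W => connectedComponentIn W (z : Fin k → ℝ) with hComps
  by_contra hgt
  rw [not_le] at hgt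
  -- `C + 1` distinct components with representatives
  have hle : ((C + 1 : ℕ) : ℕ∞) ≤ Comps.encard := by
    rw [Nat.cast_add_one]; exact Order.add_one_le_of_lt hgt
  obtain ⟨T, hTsub, hTcard⟩ := Set.exists_subset_encard_eq hle
  have hTfin : T.Finite := finite_of_encard_le_coe hTcard.le
  set Tf := hTfin.toFinset with hTf
  have hTfcard : Tf.card = C + 1 := by
    have := hTfin.encard_eq_coe_toFinset_card
    rw [hTcard] at this
    exact_mod_cast this.symm
  have hTfne : Tf.Nonempty := by rw [← Finset.card_pos, hTfcard]; omega
  have hrep : ∀ A ∈ Tf, ∃ a ∈ W, connectedComponentIn W a = A := by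
    intro A hA
    rw [hTf, hTfin.mem_toFinset] at hA
    obtain ⟨⟨a, ha⟩, rfl⟩ := hTsub hA
    exact ⟨a, ha, rfl⟩
  choose! rep hrepW hrepA using hrep
  have hAW : ∀ A ∈ Tf, A ⊆ W := fun A hA => by
    rw [← hrepA A hA]; exact connectedComponentIn_subset _ _
  have hrepmem : ∀ A ∈ Tf, rep A ∈ A := fun A hA => by
    have h := mem_connectedComponentIn (F := W) (hrepW A hA)
    rwa [hrepA A hA] at h
  have hAclosed : ∀ A ∈ Tf, IsClosed A := fun A hA => by
    -- a connected component of the closed set `W` is closed: its closure is a connected subset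
    -- of `W` containing it
    rw [← hrepA A hA]
    refine isClosed_of_closure_subset (IsPreconnected.subset_connectedComponentIn
      isPreconnected_connectedComponentIn.closure
      (subset_closure (mem_connectedComponentIn (hrepW A hA))) ?_)
    exact (closure_mono (connectedComponentIn_subset _ _)).trans (isClosed_zeroSetR g β).closure_subset
  have hregW : ∀ x, sysFun g β x = 0 → ∃ f' : (Fin k → ℝ) →L[ℝ] (Fin q → ℝ),
      HasStrictFDerivAt (sysFun g β) f' x ∧ f'.range = ⊤ := fun x hx =>
    ⟨_, hasStrictFDerivAt_sysFun_of_regular g β (hreg x hx)⟩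
  have hdiffclosed : ∀ A ∈ Tf, IsClosed (W \ A) := fun A hA => by
    rw [← hrepA A hA]
    exact Literature.Analysis.Calculus.isClosed_diff_connectedComponentIn
      (contDiff_sysFun g β (m := 0)).continuous hregW _
  have hdisj : ∀ A ∈ Tf, ∀ A' ∈ Tf, A ≠ A' → Disjoint A A' := by
    intro A hA A' hA' hne
    rw [← hrepA A hA, ← hrepA A' hA'] at hne ⊢
    exact disjoint_of_ne_connectedComponentIn hne
  -- compact pieces
  set R : ℝ := Tf.sup' hTfne (fun A => sqd 0 (rep A)) + 1 with hR
  set Kc : Set (Fin k → ℝ) → Set (Fin k → ℝ) := fun A => A ∩ {z | sqd 0 z ≤ R} with hKc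
  have hKcc : ∀ A ∈ Tf, IsCompact (Kc A) := fun A hA =>
    (isCompact_setOf_sqd_zero_le R).inter_left (hAclosed A hA)
  have hKcne : ∀ A ∈ Tf, (Kc A).Nonempty := fun A hA =>
    ⟨rep A, hrepmem A hA, by
      show sqd 0 (rep A) ≤ R
      have := Finset.le_sup' (fun A => sqd 0 (rep A)) hA
      rw [hR]; linarith⟩
  -- collars
  have hcoll : ∀ A ∈ Tf, ∃ ηA > 0, Disjoint (cthickening ηA (Kc A)) (cthickening ηA (W \ A)) :=
    fun A hA => Disjoint.exists_cthickenings
      (Set.disjoint_left.2 fun x hx hx' => hx'.2 hx.1) (hKcc A hA) (hdiffclosed A hA)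
  choose! ηA hηA hηdisj using hcoll
  set η := Tf.inf' hTfne ηA with hη
  have hηpos : 0 < η := (Finset.lt_inf'_iff hTfne).2 fun A hA => hηA A hA
  have hηle : ∀ A ∈ Tf, η ≤ ηA A := fun A hA => Finset.inf'_le ηA hA
  set U : Set (Fin k → ℝ) → Set (Fin k → ℝ) := fun A => cthickening η (Kc A) with hU
  have hUc : ∀ A ∈ Tf, IsCompact (U A) := fun A hA => (hKcc A hA).cthickening
  have hUW : ∀ A ∈ Tf, U A ∩ W ⊆ A := by
    intro A hA x hx
    by_contra hxA
    have h1 : x ∈ cthickening (ηA A) (Kc A) := cthickening_mono (hηle A hA) _ hx.1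
    have h2 : x ∈ cthickening (ηA A) (W \ A) := self_subset_cthickening _ ⟨hx.2, hxA⟩
    exact Set.disjoint_left.1 (hηdisj A hA) h1 h2
  have hUdisj : ∀ A ∈ Tf, ∀ A' ∈ Tf, A ≠ A' → Disjoint (U A) (U A') := by
    intro A hA A' hA' hne
    have h1 : U A ⊆ cthickening (ηA A) (Kc A) := cthickening_mono (hηle A hA) _
    have h2 : U A' ⊆ cthickening (ηA A) (W \ A) := by
      refine (cthickening_mono (hηle A hA) _).trans (cthickening_subset_of_subset _ ?_)
      intro x hx
      exact ⟨hAW A' hA' hx.1, fun hxA => Set.disjoint_left.1 (hdisj A hA A' hA' hne) hxA hx.1⟩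
    exact (hηdisj A hA).mono h1 h2
  have hthick : ∀ A ∈ Tf, thickening η (Kc A) ⊆ U A := fun A hA => thickening_subset_cthickening _ _
  -- local minima in every collar for small `θ`
  have hgood : ∀ A ∈ Tf, ∃ ε > 0, ∀ θ : Fin (k + q) → ℝ, ‖θ‖ < ε →
      ∃ z ∈ U A, (∀ i, (g i).realize (Sum.elim β z) = θ (Fin.natAdd k i)) ∧
        LinearIndependent ℝ (fun i => grad (g i) β z) ∧
        IsLocalMinOn (sqd fun j => θ (Fin.castAdd q j))
          {z' | ∀ i, (g i).realize (Sum.elim β z') = θ (Fin.natAdd k i)} z := fun A hA =>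
    exists_forall_isLocalMinOn g β hreg (hAW A hA) rfl (hKcne A hA) (hKcc A hA) (hUc A hA) (hUW A hA)
      hηpos (hthick A hA)
  choose! εA hεA hgoodA using hgood
  set ε := Tf.inf' hTfne εA with hε
  have hεpos : 0 < ε := (Finset.lt_inf'_iff hTfne).2 fun A hA => hεA A hA
  have hεle : ∀ A ∈ Tf, ε ≤ εA A := fun A hA => Finset.inf'_le εA hA
  -- Sard: a regular value `θ` of `Ψ_β` in the ball of radius `ε`
  set Bad := lagMap g β '' {w | (fderiv ℝ (lagMap g β) w).det = 0} with hBad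
  have hBadnull : volume Bad = 0 :=
    addHaar_image_eq_zero_of_det_fderivWithin_eq_zero (μ := volume)
      (f' := fun w => fderiv ℝ (lagMap g β) w)
      (fun w _ => (((contDiff_lagMap g β (n := 1)).differentiable one_ne_zero) w).hasFDerivAt.hasFDerivWithinAt)
      (fun w hw => hw)
  obtain ⟨θ, hθball, hθBad⟩ := exists_mem_ball_notMem hBadnull hεpos
  have hθnorm : ‖θ‖ < ε := by rwa [mem_ball, dist_zero_right] at hθball
  -- in each collar a zero `w_A` of `Ψ_β - θ`, pairwise distinct, all non-degenerate
  have hzeros : ∀ A ∈ Tf, ∃ w : Fin (k + q) → ℝ, (fun j => w (Fin.castAdd q j)) ∈ U A ∧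
      w ∈ ndZeros (lagSys g) (Fin.append β θ) := by
    intro A hA
    obtain ⟨z, hzU, hlev, hli, hmin⟩ := hgoodA A hA θ (hθnorm.trans_le (hεle A hA))
    obtain ⟨lam, hlam⟩ := exists_multipliers g β hlev hli hmin
    refine ⟨Fin.append z lam, by simpa using hzU, ?_⟩
    have hΨ : lagMap g β (Fin.append z lam) = θ := by
      rw [lagMap_append_eq_append g β hlam hlev]
      exact Fin.append_castAdd_natAdd
    rw [mem_ndZeros_lagSys_iff]
    refine ⟨hΨ, fun hdet => hθBad ⟨Fin.append z lam, hdet, hΨ⟩⟩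
  choose! w hwU hwnd using hzeros
  have hinj : Set.InjOn w ↑Tf := by
    intro A hA A' hA' heq
    by_contra hne
    have h1 := hwU A hA
    have h2 := hwU A' hA'
    rw [heq] at h1
    exact Set.disjoint_left.1 (hUdisj A hA A' hA' hne) h1 h2
  have hsub : (↑(Tf.image w) : Set (Fin (k + q) → ℝ)) ⊆ ndZeros (lagSys g) (Fin.append β θ) := by
    intro x hx
    rw [Finset.coe_image] at hx
    obtain ⟨A, hA, rfl⟩ := hx
    exact hwnd A hA
  have h1 : ((C + 1 : ℕ) : ℕ∞) ≤ (ndZeros (lagSys g) (Fin.append β θ)).encard := by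
    rw [← hTfcard, ← Finset.card_image_of_injOn hinj, ← Set.encard_coe_eq_coe_finsetCard]
    exact Set.encard_le_encard hsub
  have h2 := hC (Fin.append β θ)
  have h3 : ((C + 1 : ℕ) : ℕ∞) ≤ (C : ℕ∞) := h1.trans h2
  have h4 : C + 1 ≤ C := by exact_mod_cast h3
  omega

end Khovanskii

end Literature.ModelTheory.ExponentialFields
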